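import Mathlib
import Summits.Ventures.Crystal3D.Theorems.StickyWulffConstantTextureLiminfTexShadowRungsDefs
import Literature.Analysis.Convexity.AnisotropicPerimeterPolytopePrism
import Literature.Analysis.Convexity.OpenHPolytope
import HarnessLib

/-!
# Line `TexShadow` (crux `TextureLiminf`, stmt-Ventures-19483): rung `rung_perBox`

HONEST FRAMING. Part of the venture `Summits/Ventures/Crystal3D` (cell `crystal3d-full`), route
`route-Ventures-StickyWulffConstant`, crux `TextureLiminf` (stmt-Ventures-19483), line `TexShadow`; the
planner's rungs file `HOME/cf-p1/route/lines/tex/TexShadowRungs.lean` (cf-p1 gen 16, evidence on the item)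
names two provable special cases of the facet calculus `stub_polytopeCalculus`.  This file proves the
first one in the planner's spelling (namespace `…TexShadow.Rungs`, definitions `box`, `e` of
`…TexShadowRungsDefs.lean`, `per`/`supportFn` of `…TexShadowDefs.lean`):
`Per_K(box a b) = Σ_t (h_K(e_t) + h_K(−e_t)) · Π_{t' ≠ t} (b_{t'} − a_{t'})` for every compact convex `K ∋ 0`
— clause (A) (`Literature.Analysis.Convexity.toReal_anisotropicPerimeter_iInter_halfSpace_lt_eq_facetSum`,
lit g8 / eng g5) applied to the six-facet `H`-representation of the box, with the facet prisms computed as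
coordinate boxes (`volume_coordBox`, `prism_topFacet_eq`, `prism_bottomFacet_eq`).
WHAT THIS IS NOT: a registered stub; rung F-C1 not moved.
-/

noncomputable section

open scoped BigOperators InnerProductSpace ENNReal
open MeasureTheory

namespace Summit.Ventures.Crystal3D.Cruxes.TextureLiminf.TexShadow.Rungs

open Literature.Analysis.Convexity

/-! ### Coordinate bookkeeping in `E3` -/

/-- `⟪e t, x⟫ = x t`. -/
theorem inner_e_left (t : Fin 3) (x : E3) : ⟪e t, x⟫_ℝ = x t := by
  simp [e, EuclideanSpace.inner_single_left]

/-- coordinates of `e t` (local helper). -/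
private theorem e_apply' (t t' : Fin 3) : (e t) t' = if t = t' then 1 else 0 := by
  by_cases h : t = t'
  · subst h; simp [e]
  · have h' : t' ≠ t := fun h' => h h'.symm
    simp [e, h, h']

/-- The volume of a closed coordinate box of `E3` is the product of its side lengths. -/
theorem volume_coordBox (lo hi : Fin 3 → ℝ) (h : ∀ t, lo t ≤ hi t) :
    (volume {x : E3 | ∀ t, lo t ≤ x t ∧ x t ≤ hi t}).toReal = ∏ t, (hi t - lo t) := by
  have hset : {x : E3 | ∀ t, lo t ≤ x t ∧ x t ≤ hi t} =
      (WithLp.ofLp : E3 → (Fin 3 → ℝ)) ⁻¹' Set.Icc lo hi := by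
    ext x
    simp only [Set.mem_setOf_eq, Set.mem_preimage, Set.mem_Icc, Pi.le_def]
    exact ⟨fun h => ⟨fun t => (h t).1, fun t => (h t).2⟩, fun h t => ⟨h.1 t, h.2 t⟩⟩
  rw [hset, (PiLp.volume_preserving_ofLp (ι := Fin 3)).measure_preimage
    measurableSet_Icc.nullMeasurableSet, Real.volume_Icc_pi, ENNReal.toReal_prod]
  exact Finset.prod_congr rfl fun t _ => ENNReal.toReal_ofReal (sub_nonneg.2 (h t))

/-- The `H`-representation of the open box: constraints `(e t, b t)` and `(-e t, -a t)`. -/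
theorem box_eq_iInter (a b : E3) :
    box a b = ⋂ p ∈ ((Finset.univ : Finset (Fin 3)).image (fun t => (e t, b t)) ∪
      (Finset.univ : Finset (Fin 3)).image (fun t => (-(e t), -(a t)))), {x : E3 | ⟪p.1, x⟫_ℝ < p.2} := by
  ext x
  simp only [box, Set.mem_setOf_eq, Set.mem_iInter, Finset.mem_union, Finset.mem_image,
    Finset.mem_univ, true_and]
  constructor
  · rintro hx p (⟨t, rfl⟩ | ⟨t, rfl⟩)
    · simpa [inner_e_left] using (hx t).2
    · simpa [inner_neg_left, inner_e_left] using (hx t).1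
  · intro hx t
    refine ⟨?_, ?_⟩
    · have := hx (-(e t), -(a t)) (Or.inr ⟨t, rfl⟩)
      simpa [inner_neg_left, inner_e_left] using this
    · have := hx (e t, b t) (Or.inl ⟨t, rfl⟩)
      simpa [inner_e_left] using this

/-- The closure of a nondegenerate open box is the closed box. -/
theorem closure_box (a b : E3) (hab : ∀ t, a t < b t) :
    closure (box a b) = {x : E3 | ∀ t, a t ≤ x t ∧ x t ≤ b t} := by
  have hne : (box a b).Nonempty := by
    refine ⟨(2 : ℝ)⁻¹ • (a + b), fun t => ?_⟩
    simp only [PiLp.smul_apply, PiLp.add_apply, smul_eq_mul]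
    constructor <;> nlinarith [hab t]
  rw [box_eq_iInter] at hne ⊢
  rw [closure_openHPolytope_eq _ hne]
  ext x
  simp only [Set.mem_iInter, Set.mem_setOf_eq, Finset.mem_union, Finset.mem_image, Finset.mem_univ,
    true_and]
  constructor
  · intro hx t
    refine ⟨?_, ?_⟩
    · have := hx (-(e t), -(a t)) (Or.inr ⟨t, rfl⟩)
      simpa [inner_neg_left, inner_e_left] using this
    · have := hx (e t, b t) (Or.inl ⟨t, rfl⟩)
      simpa [inner_e_left] using this
  · rintro hx p (⟨t, rfl⟩ | ⟨t, rfl⟩)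
    · simpa [inner_e_left] using (hx t).2
    · simpa [inner_neg_left, inner_e_left] using (hx t).1

/-- The unit prism over the top facet `x t = b t` of the closed box is a coordinate box. -/
theorem prism_topFacet_eq (a b : E3) (hab : ∀ t, a t < b t) (t : Fin 3) :
    {x : E3 | ∃ y ∈ {x : E3 | ∀ t, a t ≤ x t ∧ x t ≤ b t} ∩ {x : E3 | ⟪e t, x⟫_ℝ = b t},
      ∃ s ∈ Set.Icc (0 : ℝ) 1, x = y + s • e t} =
    {x : E3 | ∀ t', (Function.update (fun l => a l) t (b t)) t' ≤ x t' ∧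
      x t' ≤ (Function.update (fun l => b l) t (b t + 1)) t'} := by
  ext x
  simp only [Set.mem_setOf_eq, Set.mem_inter_iff, inner_e_left, Set.mem_Icc]
  constructor
  · rintro ⟨y, ⟨hy, hyt⟩, s, ⟨hs0, hs1⟩, rfl⟩ t'
    by_cases ht : t' = t
    · subst ht
      simp only [Function.update_self, PiLp.add_apply, PiLp.smul_apply, e_apply', if_true, smul_eq_mul,
        mul_one]
      constructor <;> linarith
    · simp only [Function.update_of_ne ht, PiLp.add_apply, PiLp.smul_apply, e_apply', if_neg (Ne.symm ht),
        smul_eq_mul, mul_zero, add_zero]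
      exact hy t'
  · intro hx
    refine ⟨x - (x t - b t) • e t, ⟨fun t' => ?_, ?_⟩, x t - b t, ⟨?_, ?_⟩, ?_⟩
    · by_cases ht : t' = t
      · subst ht
        simp only [PiLp.sub_apply, PiLp.smul_apply, e_apply', if_true, smul_eq_mul, mul_one]
        constructor <;> linarith [hab t']
      · have := hx t'
        simp only [Function.update_of_ne ht] at this
        simp only [PiLp.sub_apply, PiLp.smul_apply, e_apply', if_neg (Ne.symm ht), smul_eq_mul, mul_zero, sub_zero]
        exact this
    · simp only [PiLp.sub_apply, PiLp.smul_apply, e_apply', if_true, smul_eq_mul, mul_one]; ring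
    · have := hx t; simp only [Function.update_self] at this; linarith
    · have := hx t; simp only [Function.update_self] at this; linarith
    · rw [sub_add_cancel]

/-- The unit prism under the bottom facet `x t = a t` of the closed box is a coordinate box. -/
theorem prism_bottomFacet_eq (a b : E3) (hab : ∀ t, a t < b t) (t : Fin 3) :
    {x : E3 | ∃ y ∈ {x : E3 | ∀ t, a t ≤ x t ∧ x t ≤ b t} ∩ {x : E3 | ⟪-(e t), x⟫_ℝ = -(a t)},
      ∃ s ∈ Set.Icc (0 : ℝ) 1, x = y + s • (-(e t))} =
    {x : E3 | ∀ t', (Function.update (fun l => a l) t (a t - 1)) t' ≤ x t' ∧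
      x t' ≤ (Function.update (fun l => b l) t (a t)) t'} := by
  ext x
  simp only [Set.mem_setOf_eq, Set.mem_inter_iff, inner_neg_left, inner_e_left, neg_inj, Set.mem_Icc]
  constructor
  · rintro ⟨y, ⟨hy, hyt⟩, s, ⟨hs0, hs1⟩, rfl⟩ t'
    by_cases ht : t' = t
    · subst ht
      simp only [Function.update_self, PiLp.add_apply, PiLp.smul_apply, PiLp.neg_apply, e_apply', if_true,
        smul_eq_mul, mul_neg, mul_one]
      constructor <;> linarith
    · simp only [Function.update_of_ne ht, PiLp.add_apply, PiLp.smul_apply, PiLp.neg_apply, e_apply',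
        if_neg (Ne.symm ht), neg_zero, smul_eq_mul, mul_zero, add_zero]
      exact hy t'
  · intro hx
    refine ⟨x + (a t - x t) • e t, ⟨fun t' => ?_, ?_⟩, a t - x t, ⟨?_, ?_⟩, ?_⟩
    · by_cases ht : t' = t
      · subst ht
        simp only [PiLp.add_apply, PiLp.smul_apply, e_apply', if_true, smul_eq_mul, mul_one]
        constructor <;> linarith [hab t']
      · have := hx t'
        simp only [Function.update_of_ne ht] at this
        simp only [PiLp.add_apply, PiLp.smul_apply, e_apply', if_neg (Ne.symm ht), smul_eq_mul, mul_zero, add_zero]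
        exact this
    · simp only [PiLp.add_apply, PiLp.smul_apply, e_apply', if_true, smul_eq_mul, mul_one]; ring
    · have := hx t; simp only [Function.update_self] at this; linarith
    · have := hx t; simp only [Function.update_self] at this; linarith
    · ext l
      simp only [PiLp.add_apply, PiLp.smul_apply, PiLp.neg_apply, smul_eq_mul]
      ring

/-- The facet areas of the box: both prisms over the `t`-facets have volume `Π_{t' ≠ t} (b t' - a t')`. -/
theorem volume_prism_facets (a b : E3) (hab : ∀ t, a t < b t) (t : Fin 3) :
    (volume {x : E3 | ∃ y ∈ {x : E3 | ∀ t, a t ≤ x t ∧ x t ≤ b t} ∩ {x : E3 | ⟪e t, x⟫_ℝ = b t},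
      ∃ s ∈ Set.Icc (0 : ℝ) 1, x = y + s • e t}).toReal = ∏ t' ∈ Finset.univ.erase t, (b t' - a t') ∧
    (volume {x : E3 | ∃ y ∈ {x : E3 | ∀ t, a t ≤ x t ∧ x t ≤ b t} ∩ {x : E3 | ⟪-(e t), x⟫_ℝ = -(a t)},
      ∃ s ∈ Set.Icc (0 : ℝ) 1, x = y + s • (-(e t))}).toReal = ∏ t' ∈ Finset.univ.erase t, (b t' - a t') := by
  constructor
  · rw [prism_topFacet_eq a b hab t, volume_coordBox _ _ (fun t' => by
      by_cases ht : t' = t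
      · subst ht; simp
      · simp [Function.update_of_ne ht, (hab t').le])]
    rw [← Finset.mul_prod_erase _ _ (Finset.mem_univ t)]
    simp only [Function.update_self, add_sub_cancel_left, one_mul]
    exact Finset.prod_congr rfl fun t' ht' => by
      rw [Function.update_of_ne (Finset.ne_of_mem_erase ht'), Function.update_of_ne (Finset.ne_of_mem_erase ht')]
  · rw [prism_bottomFacet_eq a b hab t, volume_coordBox _ _ (fun t' => by
      by_cases ht : t' = t
      · subst ht; simp
      · simp [Function.update_of_ne ht, (hab t').le])]
    rw [← Finset.mul_prod_erase _ _ (Finset.mem_univ t)]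
    simp only [Function.update_self, sub_sub_cancel, one_mul]
    exact Finset.prod_congr rfl fun t' ht' => by
      rw [Function.update_of_ne (Finset.ne_of_mem_erase ht'), Function.update_of_ne (Finset.ne_of_mem_erase ht')]

/-- **rung (anisotropic perimeter of a box)**.  `Per_K(box) = Σ_t (h_K(e_t) + h_K(−e_t)) · Π_{t' ≠ t} (b_{t'} − a_{t'})`
for every compact convex `K ∋ 0` — clause (A) of `PolytopeCalculus` for the six-facet polytope `box a b`. -/
theorem rung_perBox :
    ∀ K : Set E3, IsCompact K → Convex ℝ K → (0 : E3) ∈ K → ∀ a b : E3, (∀ t, a t < b t) →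
      per K (box a b) =
        ∑ t : Fin 3, (supportFn K (e t) + supportFn K (-(e t))) *
          ∏ t' ∈ Finset.univ.erase t, (b t' - a t') := by
  classical
  intro K hKc hK hK0 a b hab
  set H : Finset (E3 × ℝ) := (Finset.univ : Finset (Fin 3)).image (fun t => (e t, b t)) ∪
    (Finset.univ : Finset (Fin 3)).image (fun t => (-(e t), -(a t))) with hH
  have hbox : box a b = ⋂ p ∈ H, {x : E3 | ⟪p.1, x⟫_ℝ < p.2} := box_eq_iInter a b
  -- hypotheses of the facet formula
  have hbdd : Bornology.IsBounded (⋂ p ∈ H, {x : E3 | ⟪p.1, x⟫_ℝ < p.2}) := by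
    rw [← hbox]
    refine (Metric.isBounded_closedBall (x := (0 : E3)) (r := ‖a‖ + ‖b‖)).subset fun x hx => ?_
    rw [mem_closedBall_zero_iff]
    have hsq : ‖x‖ ^ 2 ≤ ‖a‖ ^ 2 + ‖b‖ ^ 2 := by
      rw [norm_sq_eq_sum_sq_coord, norm_sq_eq_sum_sq_coord, norm_sq_eq_sum_sq_coord, ← Finset.sum_add_distrib]
      refine Finset.sum_le_sum fun t _ => ?_
      obtain ⟨h1, h2⟩ := hx t
      rcases le_or_gt 0 (x t) with h | h <;> nlinarith
    nlinarith [norm_nonneg x, norm_nonneg a, norm_nonneg b]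
  have h1 : ∀ p ∈ H, ‖p.1‖ = 1 := by
    intro p hp
    rw [hH, Finset.mem_union, Finset.mem_image, Finset.mem_image] at hp
    rcases hp with ⟨t, -, rfl⟩ | ⟨t, -, rfl⟩
    · simp [e]
    · simp [e]
  -- every constraint plane is a coordinate plane `{x t = γ}`
  have hplane : ∀ p ∈ H, ∃ t γ, (γ = b t ∨ γ = a t) ∧ (p = (e t, b t) ∧ γ = b t ∨ p = (-(e t), -(a t)) ∧ γ = a t) ∧
      {x : E3 | ⟪p.1, x⟫_ℝ = p.2} = {x : E3 | x t = γ} := by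
    intro p hp
    rw [hH, Finset.mem_union, Finset.mem_image, Finset.mem_image] at hp
    rcases hp with ⟨t, -, rfl⟩ | ⟨t, -, rfl⟩
    · exact ⟨t, b t, Or.inl rfl, Or.inl ⟨rfl, rfl⟩, by ext x; simp [inner_e_left]⟩
    · exact ⟨t, a t, Or.inr rfl, Or.inr ⟨rfl, rfl⟩, by ext x; simp [inner_neg_left, inner_e_left, neg_inj]⟩
  have hd : ∀ p ∈ H, ∀ p' ∈ H, p ≠ p' → {x : E3 | ⟪p.1, x⟫_ℝ = p.2} ≠ {x : E3 | ⟪p'.1, x⟫_ℝ = p'.2} := by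
    intro p hp p' hp' hne heq
    obtain ⟨t, γ, hγ, hpγ, hpl⟩ := hplane p hp
    obtain ⟨t', γ', hγ', hpγ', hpl'⟩ := hplane p' hp'
    rw [hpl, hpl'] at heq
    -- a point in the first plane with prescribed `t'`-coordinate
    by_cases htt : t = t'
    · subst htt
      have hγγ : γ = γ' := by
        have : (EuclideanSpace.single t γ : E3) ∈ {x : E3 | x t = γ} := by simp
        rw [heq] at this
        simpa using this
      apply hne
      rcases hpγ with ⟨rfl, rfl⟩ | ⟨rfl, rfl⟩ <;> rcases hpγ' with ⟨rfl, h'⟩ | ⟨rfl, h'⟩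
      · rfl
      · exact absurd (hγγ.trans h') (hab t).ne'
      · exact absurd (hγγ.trans h') (hab t).ne
      · rfl
    · have : (EuclideanSpace.single t γ + EuclideanSpace.single t' (γ' + 1) : E3) ∈ {x : E3 | x t = γ} := by
        simp [htt]
      rw [heq] at this
      simp [Ne.symm htt] at this
  -- the facet formula (A)
  simp only [per, perK_eq_anisotropicPerimeter, supportFn]
  rw [hbox, toReal_anisotropicPerimeter_iInter_halfSpace_lt_eq_facetSum H hbdd h1 hd hKc hK hK0, ← hbox,
    closure_box a b hab]
  -- evaluate the facet sum
  have hdisjH : Disjoint ((Finset.univ : Finset (Fin 3)).image (fun t => (e t, b t)))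
      ((Finset.univ : Finset (Fin 3)).image (fun t => ((-(e t), -(a t)) : E3 × ℝ))) := by
    rw [Finset.disjoint_left]
    intro p hp hp'
    rw [Finset.mem_image] at hp hp'
    obtain ⟨t, -, rfl⟩ := hp
    obtain ⟨t', -, h⟩ := hp'
    have := congrArg (fun q : E3 × ℝ => q.1 t) h
    by_cases htt : t = t'
    · subst htt; simp [e] at this; linarith
    · simp [e, htt] at this
  have hinj1 : Set.InjOn (fun t : Fin 3 => ((e t, b t) : E3 × ℝ)) (Finset.univ : Finset (Fin 3)) := by
    intro t _ t' _ h
    by_contra htt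
    have := congrArg (fun q : E3 × ℝ => q.1 t) h
    simp [e, htt] at this
  have hinj2 : Set.InjOn (fun t : Fin 3 => ((-(e t), -(a t)) : E3 × ℝ)) (Finset.univ : Finset (Fin 3)) := by
    intro t _ t' _ h
    by_contra htt
    have := congrArg (fun q : E3 × ℝ => q.1 t) h
    simp [e, htt] at this
  rw [hH, Finset.sum_union hdisjH, Finset.sum_image hinj1, Finset.sum_image hinj2, ← Finset.sum_add_distrib]
  refine Finset.sum_congr rfl fun t _ => ?_
  obtain ⟨htop, hbot⟩ := volume_prism_facets a b hab t
  simp only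
  rw [htop, hbot]
  ring

end Summit.Ventures.Crystal3D.Cruxes.TextureLiminf.TexShadow.Rungs

end
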